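import Literature.Probability.Percolation.TwoClusterGibbsSampler
import Literature.Combinatorics.Sahi2008.Percolation
import Literature.Combinatorics.Sahi2008.FKG
import HarnessLib

/-!
# Sahi positivity of every order passes from product measures to the BHK two-cluster
# conditional law (the "one axis" of the MASTER-FAMILY table)

Topic `Literature/Probability/Percolation`; bridge between `TwoClusterGibbsSampler.lean` (van den
Berg–Häggström–Kahn 2006, §2.1: the conditional law of `(C_S, C_T)` given `{S ↮ T}` is a limit of
monotone images of product measures) and the typer's Sahi (2008) vocabulary
`Literature/Combinatorics/Sahi2008/` (`sahiE`, `SahiPositive`, `bernoulliWeight`).  ALL declarations are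
definitions with bodies or theorems (no named fact; the open Sahi/Kahn positivity enters only as an
explicit hypothesis of the conditional statements).  Written for the one-cut programme of
stmt-CriticalPhenomena-4575 (run/shared/lean/prim/MASTER-FAMILY.md, "ONE AXIS, NOT TWO";
prim-sahi/PLAN-lead.md S6 (4)).

## Sources, as printed

* BHK [`lit read doi:10.1002/rsa.20102`, preprint pp.], §2.1 p. 9: "**Theorem 2.1.** … Let `S` and `T`
  be disjoint sets of vertices, and `f` and `g` bounded, measurable functions of `(C_S, C_T)`, each
  increasing in `C_S` and decreasing in `C_T`. Then on `{S ↮ T}`, `E f g ≥ E f E g`"; p. 10: "We write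
  `φ` for the measure `φ_{G,q}` conditioned on `Q` and `φ̂` for the measure which `φ` induces on `Ω̂`";
  p. 11: "so to prove Theorem 2.1 it's enough to show **Claim 2.5.** For `f, g` as in the statement of
  Theorem 2.1 and any `n`, (12) holds for expectation taken with respect to the law of `(C_S^n, C_T^n)`."
* Lieb–Sahi [arXiv:2107.09838], Def. 3.1 / Prop. 3.3 (the functionals `E_n` and their recursion) and
  Conj. 1.1 ("If `f_1,…,f_n` are positive monotone functions on an FKG poset then
  `E_n(f_1,…,f_n) ≥ 0`"); Sahi [Combinatorica 28 (2008)], Thm. 2 (p. 211) and Conj. 5 (p. 213);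
  Kahn [arXiv:2210.08653], p. 2 (UI measures) and Conj. 5 (p. 3: the product-measure, `n = 3` case,
  "thoroughly intractable").

## What is proved

* `BHK2006.condPairWeight w S T`: BHK's `φ̂` at `q = 1` — the conditional law of `(C_S, C_T)` given
  `D = {S ↮ T}` as a weight on the poset `Set (Sym2 V) × (Set (Sym2 V))ᵒᵈ` ("increasing in `C_S` and
  decreasing in `C_T`" = increasing), with `E_{φ̂}[h] = (∫_D h(C_S, C_T) dμ)/μ(D)`
  (`ex_condPairWeight`).
* `BHK2006.sahiE_eq_of_ex_eq` (`E_n` of a push-forward weight is `E_n` of the pulled-back functions)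
  and `BHK2006.continuous_sahiE` (`E_n^ν(f)` is continuous in the weight `ν`) — the two structural
  facts about the Lieb–Sahi recursion used in the limit argument.
* **`sahiPositive_condPairWeight_of_product`**: for every `n`, if `SahiPositive (bernoulliWeight q) n`
  for all finite `β` and `q ∈ [0,1]^β` (Sahi's `C_n` for product measures on finite cubes), then
  `SahiPositive (condPairWeight w S T) n` (every non-loop pair at `T` of probability `< 1`, `μ(D) > 0`).
  Proof: BHK's Claim-2.5 route — the law of the chain after `N` steps is a monotone image of a product
  measure (`BHK2006.gibbsE_iterate_fui`), so `C_n` holds along the chain; the laws converge to `φ̂`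
  (`BHK2006.gibbs_sum_sub_le`) and `E_n` is continuous.
* `sahiPositive_two_condPairWeight`: the case `n = 2` UNCONDITIONALLY (Harris for product weights,
  `sahiPositive_two` + `isFKGMeasure_bernoulliWeight`) — Theorem 2.1 at `q = 1` in Sahi's vocabulary.
* `BHK2006.condPairProb w S T E = μ(D ∩ {(C_S, C_T) ∈ E})/μ(D)` (`= E_{φ̂}[1_E]`, `ex_condPairWeight_ind`)
  and `condSahiE3_nonneg_of_product`: the `n = 3` member written out in these conditional
  probabilities for three events increasing in `C_S` / decreasing in `C_T` — the
  "(3, BHK) ⇐ (3, product)" entry of the MASTER-FAMILY table, conditional on Kahn's/Sahi's open `n = 3`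
  positivity.
-/

noncomputable section

open MeasureTheory unitInterval
open Literature.Probability.LatticeModels (prodBernoulli)

namespace Literature.Probability.Percolation

/-! ### Sahi positivity of every order passes from product measures to the conditional law -/

section Sahi

universe u

variable {V : Type u} [Fintype V]

open scoped Classical
open BHK2006 DecisionTree Filter Topology
open Literature.Combinatorics.Sahi2008 (ex ex_def sahiE SahiPositive bernoulliWeight sahiE_zero
  sahiE_one_apply sahiE_succ_succ sahiPositive_two isFKGMeasure_bernoulliWeight)

/-- **`E_n` of a push-forward weight is `E_n` of the pulled-back functions**: if `E_ν[h] = E_μ[h ∘ g]`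
for every `h`, then `E_n^ν(f_0,…,f_{n-1}) = E_n^μ(f_0 ∘ g, …, f_{n-1} ∘ g)` (the functional only sees
expectations of products of the `f_i`). [cite: LiebSahi2021, Def. 3.1 and Prop. 3.3 (the recursion defining `E_n` through expectations of products)] -/
theorem BHK2006.sahiE_eq_of_ex_eq {α γ : Type*} [Fintype α] [Fintype γ] (ν : α → ℝ) (μ : γ → ℝ)
    (g : γ → α) (hex : ∀ h : α → ℝ, ex ν h = ex μ (h ∘ g)) :
    ∀ (n : ℕ) (f : Fin n → α → ℝ), sahiE ν n f = sahiE μ n (fun i => f i ∘ g)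
  | 0, f => by rw [sahiE_zero, sahiE_zero]
  | 1, f => by rw [sahiE_one_apply, sahiE_one_apply]; exact hex _
  | n + 2, f => by
    rw [sahiE_succ_succ, sahiE_succ_succ, hex,
      BHK2006.sahiE_eq_of_ex_eq ν μ g hex (n + 1) (Fin.tail f)]
    congr 1
    refine Finset.sum_congr rfl fun i _ => ?_
    rw [BHK2006.sahiE_eq_of_ex_eq ν μ g hex (n + 1)]
    congr 1
    funext j x
    simp only [Function.comp_apply, Function.update_apply, Fin.tail]
    split_ifs <;> rfl

/-- **`E_n^ν(f)` is continuous in the weight `ν`** (a polynomial in the finitely many values `ν(x)`).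
[cite: LiebSahi2021, Def. 3.1 and Prop. 3.3] -/
theorem BHK2006.continuous_sahiE {α : Type*} [Fintype α] :
    ∀ (n : ℕ) (f : Fin n → α → ℝ), Continuous fun ν : α → ℝ => sahiE ν n f
  | 0, f => by
    simp only [sahiE_zero]
    exact continuous_const
  | 1, f => by
    simp only [sahiE_one_apply, ex_def]
    exact continuous_finsetSum _ fun x _ => (continuous_apply x).mul continuous_const
  | n + 2, f => by
    simp only [sahiE_succ_succ]
    refine Continuous.sub (continuous_finsetSum _ fun i _ => BHK2006.continuous_sahiE (n + 1) _)
      ((BHK2006.continuous_sahiE (n + 1) _).mul ?_)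
    simp only [ex_def]
    exact continuous_finsetSum _ fun x _ => (continuous_apply x).mul continuous_const

/-- **The conditional law of `(C_S, C_T)` given `{S ↮ T}` as a weight** on the poset
`Set (Sym2 V) × (Set (Sym2 V))ᵒᵈ` (`C_S` ordered by inclusion, `C_T` by REVERSE inclusion — BHK's
"increasing in `C_S` and decreasing in `C_T`" is "increasing" for this order):
`x ↦ μ(D ∩ {(C_S, C_T) = x}) / μ(D)`, `μ = prodBernoulli w`, `D = {S ↮ T}` (BHK's `φ̂`).
[cite: VandenbergHaggstromKahn2005, §2.1 p. 10 ("we write φ for the measure φ_{G,q} conditioned on Q and φ̂ for the measure which φ induces on Ω̂")] -/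
def BHK2006.condPairWeight (w : Sym2 V → unitInterval) (S T : Set V) :
    Set (Sym2 V) × (Set (Sym2 V))ᵒᵈ → ℝ := fun x =>
  (∑ ω, weight (fun e => (w e : ℝ)) ω *
      ((if (setCl ω S, OrderDual.toDual (setCl ω T)) = x then (1 : ℝ) else 0) *
        ind {ω : BondConfig V | ∀ s ∈ S, ∀ t ∈ T, ¬ (openGraph ω).Reachable s t} ω)) /
    (prodBernoulli w).real {ω : BondConfig V | ∀ s ∈ S, ∀ t ∈ T, ¬ (openGraph ω).Reachable s t}

/-- **Expectations under `φ̂` are conditional expectations**: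
`E_{φ̂}[h] = (∫_D h(C_S, C_T) dμ) / μ(D)`. [cite: VandenbergHaggstromKahn2005, §2.1 p. 10 (definition of φ̂)] -/
theorem BHK2006.ex_condPairWeight (w : Sym2 V → unitInterval) (S T : Set V)
    (h : Set (Sym2 V) × (Set (Sym2 V))ᵒᵈ → ℝ) :
    ex (condPairWeight w S T) h =
      (∫ ω in {ω : BondConfig V | ∀ s ∈ S, ∀ t ∈ T, ¬ (openGraph ω).Reachable s t},
          h (⋃ s ∈ S, openEdgeCluster ω s, OrderDual.toDual (⋃ t ∈ T, openEdgeCluster ω t))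
          ∂(prodBernoulli w)) /
        (prodBernoulli w).real
          {ω : BondConfig V | ∀ s ∈ S, ∀ t ∈ T, ¬ (openGraph ω).Reachable s t} := by
  set D : Set (BondConfig V) := {ω | ∀ s ∈ S, ∀ t ∈ T, ¬ (openGraph ω).Reachable s t} with hDdef
  have hDm : MeasurableSet D := MeasurableSet.of_discrete
  have hint : ∫ ω in D, h (⋃ s ∈ S, openEdgeCluster ω s,
      OrderDual.toDual (⋃ t ∈ T, openEdgeCluster ω t)) ∂(prodBernoulli w) =
      ∑ ω, weight (fun e => (w e : ℝ)) ω *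
        (h (setCl ω S, OrderDual.toDual (setCl ω T)) * ind D ω) := by
    rw [← integral_indicator hDm, integral_prodBernoulli_eq_sum]
    refine Finset.sum_congr rfl fun ω _ => ?_
    by_cases hω : ω ∈ D
    · rw [Set.indicator_of_mem hω, ind_of_mem hω, mul_one]; rfl
    · rw [Set.indicator_of_notMem hω, ind_of_not_mem hω]; ring
  rw [hint, ex_def]
  simp only [condPairWeight, ← hDdef, div_mul_eq_mul_div, ← Finset.sum_div]
  congr 1
  -- exchange the sums and evaluate the point masses
  have key : ∀ x : Set (Sym2 V) × (Set (Sym2 V))ᵒᵈ,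
      (∑ ω, weight (fun e => (w e : ℝ)) ω *
        ((if (setCl ω S, OrderDual.toDual (setCl ω T)) = x then (1 : ℝ) else 0) * ind D ω)) * h x =
      ∑ ω, weight (fun e => (w e : ℝ)) ω * ind D ω *
        (if (setCl ω S, OrderDual.toDual (setCl ω T)) = x then h x else 0) := by
    intro x
    rw [Finset.sum_mul]
    refine Finset.sum_congr rfl fun ω _ => ?_
    split_ifs <;> ring
  rw [Finset.sum_congr rfl fun x _ => key x, Finset.sum_comm]
  refine Finset.sum_congr rfl fun ω _ => ?_
  rw [← Finset.mul_sum, Finset.sum_ite_eq]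
  simp only [Finset.mem_univ, if_true]
  ring

/-- **Sahi positivity of every order passes from product measures to BHK's conditional law.**  If for
some `n` Sahi's `E_n ≥ 0` holds for nonnegative increasing functions under EVERY product measure on a
finite cube (`SahiPositive (bernoulliWeight q) n` for all finite `β` and `q ∈ [0,1]^β`; `n = 2` is
Harris — a theorem; `n = 3` is Sahi's Conjecture 5 / Kahn's question; `n ≥ 3` open), then `E_n ≥ 0`
holds for nonnegative functions increasing in `C_S` and decreasing in `C_T` under the conditional law
given `{S ↮ T}` (`μ(D) > 0`, every non-loop pair at `T` of probability `< 1`).  Proof: the law of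
BHK's chain after `N` steps is a monotone image of a product measure (`gibbsE_iterate_fui`), so the
hypothesis applies to it (`sahiE_eq_of_ex_eq`), and it converges to the conditional law
(`gibbs_sum_sub_le`), along which `E_n` is continuous.  This is the precise sense in which the
"BHK-conditional" members of the hierarchy (`n = 2`: the tripod/cluster-event exchanges of
`TripodExchange.lean`, `TwoSetExchange.lean`) are the product-measure members composed with one
transfer device. [cite: VandenbergHaggstromKahn2005, §2.1 pp. 10–13 (Thm. 2.1 via the chain, Claim 2.5, Remark 2.8); LiebSahi2021, Conj. 1.1 and Def. 3.1; Kahn2022, p. 2 (UI) and Conj. 5 (p. 3)] -/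
theorem sahiPositive_condPairWeight_of_product (n : ℕ)
    (hC : ∀ (β : Type u) [Fintype β] (q : β → unitInterval), SahiPositive (bernoulliWeight q) n)
    (w : Sym2 V → unitInterval) (S T : Set V)
    (hT : ∀ e : Sym2 V, ¬ e.IsDiag → (∃ v ∈ e, v ∈ T) → (w e : ℝ) < 1)
    (hD : 0 < (prodBernoulli w).real
      {ω : BondConfig V | ∀ s ∈ S, ∀ t ∈ T, ¬ (openGraph ω).Reachable s t}) :
    SahiPositive (condPairWeight w S T) n := by
  intro f hf0 hfm
  set D : Set (BondConfig V) := {ω | ∀ s ∈ S, ∀ t ∈ T, ¬ (openGraph ω).Reachable s t} with hDdef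
  have hDmem : ∀ ω, ω ∈ D ↔ ∀ s ∈ S, ∀ t ∈ T, ¬ (openGraph ω).Reachable s t := fun ω => by
    rw [hDdef]; rfl
  have hDm : MeasurableSet D := MeasurableSet.of_discrete
  set w' : Sym2 V → ℝ := fun e => (w e : ℝ) with hw'
  have hw0 : ∀ e, 0 ≤ w' e := fun e => (w e).2.1
  have hw1 : ∀ e, w' e ≤ 1 := fun e => (w e).2.2
  have hm : ∑ ω, weight w' ω = 1 := by
    have h1 := integral_prodBernoulli_eq_sum w fun _ => (1 : ℝ)
    simp only [integral_const, probReal_univ, smul_eq_mul, mul_one] at h1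
    exact h1.symm
  have hreal : (prodBernoulli w).real D = ∑ ω, weight w' ω * ind D ω := by
    rw [← integral_indicator_one hDm, integral_prodBernoulli_eq_sum]
    refine Finset.sum_congr rfl fun ω _ => ?_
    by_cases hω : ω ∈ D
    · rw [Set.indicator_of_mem hω, ind_of_mem hω, Pi.one_apply]
    · rw [Set.indicator_of_notMem hω, ind_of_not_mem hω, mul_zero]
  set Z := ∑ ω, weight w' ω * ind D ω with hZdef
  have hZ : 0 < Z := by rwa [← hreal]
  have hε : 0 < regenWeight w' T := by
    rw [hw', regenWeight_eq_prod w T]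
    exact Finset.prod_pos fun e he => by
      obtain ⟨hd, hv⟩ := (Finset.mem_filter.1 he).2
      exact sub_pos.2 (hT e hd hv)
  have hr0 : 0 ≤ 1 - regenWeight w' T := by
    have : regenWeight w' T ≤ 1 :=
      calc regenWeight w' T ≤ ∑ η, weight w' η := Finset.sum_le_sum fun η _ =>
            mul_le_of_le_one_right (weight_nonneg hw0 hw1 η) (ind_le_one _ _)
        _ = 1 := hm
    linarith
  have hr1 : 1 - regenWeight w' T < 1 := by linarith
  -- the state map into the poset and the chain's `N`-step law as a weight
  set toα : Set (Sym2 V) × Set (Sym2 V) → Set (Sym2 V) × (Set (Sym2 V))ᵒᵈ :=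
    fun y => (y.1, OrderDual.toDual y.2) with htoα
  set x₀ : Set (Sym2 V) × Set (Sym2 V) := (∅, ∅) with hx₀
  set ν : ℕ → Set (Sym2 V) × (Set (Sym2 V))ᵒᵈ → ℝ := fun N x =>
    (gibbsE w' S T)^[N] (fun y => if toα y = x then 1 else 0) x₀ with hν
  -- (1) `E_n ≥ 0` under the law of the chain after `N` steps
  have h1 : ∀ N, 0 ≤ sahiE (ν N) n f := by
    intro N
    obtain ⟨β, hβ, q, g, hq, hg, hlaw⟩ := gibbsE_iterate_fui hw0 hw1 S T x₀ N
    set q' : β → unitInterval := fun b => ⟨q b, (hq b).1, (hq b).2⟩ with hq'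
    have hgm : Monotone fun b => toα (g b) := fun b b' hbb' =>
      Prod.mk_le_mk.2 ⟨(hg b b' hbb').1, OrderDual.toDual_le_toDual.2 (hg b b' hbb').2⟩
    have hex : ∀ h : Set (Sym2 V) × (Set (Sym2 V))ᵒᵈ → ℝ,
        ex (ν N) h = ex (bernoulliWeight q') (h ∘ fun b => toα (g b)) := by
      intro h
      rw [ex_def, ex_def]
      have e1 : ∀ x, ν N x * h x = ∑ b, weight q b * (if toα (g b) = x then h x else 0) := by
        intro x
        simp only [hν, hlaw, Finset.sum_mul]
        refine Finset.sum_congr rfl fun b _ => ?_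
        split_ifs <;> ring
      simp only [e1]
      rw [Finset.sum_comm]
      refine Finset.sum_congr rfl fun b _ => ?_
      rw [← Finset.mul_sum, Finset.sum_ite_eq]
      simp only [Finset.mem_univ, if_true, Function.comp_apply]
      rfl
    rw [BHK2006.sahiE_eq_of_ex_eq (ν N) (bernoulliWeight q') (fun b => toα (g b)) hex n f]
    exact hC β q' (fun i => f i ∘ fun b => toα (g b)) (fun i b => hf0 i _)
      fun i => (hfm i).comp hgm
  -- (2) the `N`-step laws converge to the conditional law
  have h2 : Tendsto ν atTop (𝓝 (condPairWeight w S T)) := by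
    rw [tendsto_pi_nhds]
    intro x
    have hΦ : ∀ a b : Set (Sym2 V) × Set (Sym2 V),
        (fun y => if toα y = x then (1 : ℝ) else 0) a - (fun y => if toα y = x then (1 : ℝ) else 0) b
          ≤ 1 := by
      intro a b
      simp only
      split_ifs <;> norm_num
    have hbound : ∀ N, |ν N x - condPairWeight w S T x| ≤ (1 - regenWeight w' T) ^ N * 1 := by
      intro N
      have key := gibbs_sum_sub_le hw0 hw1 hm S T hDmem hΦ x₀ N
      have hcx : condPairWeight w S T x =
          (∑ ω, weight w' ω * ((if toα (setCl ω S, setCl ω T) = x then (1 : ℝ) else 0) *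
            ind D ω)) / Z := by
        simp only [condPairWeight, ← hDdef, hreal, htoα, ← hw']
      rw [hcx, abs_sub_comm]
      have : (∑ ω, weight w' ω * ((if toα (setCl ω S, setCl ω T) = x then (1 : ℝ) else 0) *
            ind D ω)) / Z - ν N x =
          ((∑ ω, weight w' ω * ((if toα (setCl ω S, setCl ω T) = x then (1 : ℝ) else 0) *
            ind D ω)) - Z * ν N x) / Z := by
        field_simp
      rw [this, abs_div, abs_of_pos hZ, div_le_iff₀ hZ]
      calc |(∑ ω, weight w' ω * ((if toα (setCl ω S, setCl ω T) = x then (1 : ℝ) else 0) *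
              ind D ω)) - Z * ν N x|
          ≤ Z * ((1 - regenWeight w' T) ^ N * 1) := key
        _ = (1 - regenWeight w' T) ^ N * 1 * Z := by ring
    have hpow : Tendsto (fun N => (1 - regenWeight w' T) ^ N * (1 : ℝ)) atTop (𝓝 0) := by
      have := (tendsto_pow_atTop_nhds_zero_of_lt_one hr0 hr1).mul_const (1 : ℝ)
      simpa using this
    rw [tendsto_iff_norm_sub_tendsto_zero]
    exact squeeze_zero (fun N => norm_nonneg _)
      (fun N => by rw [Real.norm_eq_abs]; exact hbound N) hpow
  -- (3) pass to the limit along the continuous functional `E_n`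
  exact ge_of_tendsto' (((BHK2006.continuous_sahiE n f).tendsto _).comp h2) h1

/-- **Order two, unconditionally**: the conditional law of `(C_S, C_T)` given `{S ↮ T}` is Sahi-positive
of order `2`, i.e. positively associated for functions increasing in `C_S` and decreasing in `C_T`
(BHK's Theorem 2.1 at `q = 1`, obtained here from Harris' inequality for product measures through
the sampler). [cite: VandenbergHaggstromKahn2005, Thm. 2.1 (p. 9) at q = 1; Sahi2008, Thm. 2 (p. 211) with n = 2] -/
theorem sahiPositive_two_condPairWeight (w : Sym2 V → unitInterval) (S T : Set V)
    (hT : ∀ e : Sym2 V, ¬ e.IsDiag → (∃ v ∈ e, v ∈ T) → (w e : ℝ) < 1)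
    (hD : 0 < (prodBernoulli w).real
      {ω : BondConfig V | ∀ s ∈ S, ∀ t ∈ T, ¬ (openGraph ω).Reachable s t}) :
    SahiPositive (condPairWeight w S T) 2 :=
  sahiPositive_condPairWeight_of_product 2
    (fun _ _ q => sahiPositive_two (isFKGMeasure_bernoulliWeight q)) w S T hT hD


/-- **Conditional probability of an event of the state**: `P(E) = μ(D ∩ {(C_S, C_T) ∈ E}) / μ(D)`,
`D = {S ↮ T}` (BHK's `φ̂(E)`). [cite: VandenbergHaggstromKahn2005, §2.1 p. 10 (definition of φ̂)] -/
def BHK2006.condPairProb (w : Sym2 V → unitInterval) (S T : Set V)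
    (E : Set (Set (Sym2 V) × (Set (Sym2 V))ᵒᵈ)) : ℝ :=
  (prodBernoulli w).real ({ω : BondConfig V | ∀ s ∈ S, ∀ t ∈ T, ¬ (openGraph ω).Reachable s t} ∩
      {ω | (⋃ s ∈ S, openEdgeCluster ω s, OrderDual.toDual (⋃ t ∈ T, openEdgeCluster ω t)) ∈ E}) /
    (prodBernoulli w).real {ω : BondConfig V | ∀ s ∈ S, ∀ t ∈ T, ¬ (openGraph ω).Reachable s t}

/-- `E_{φ̂}[1_E] = φ̂(E)`. [cite: VandenbergHaggstromKahn2005, §2.1 p. 10 (definition of φ̂)] -/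
theorem BHK2006.ex_condPairWeight_ind (w : Sym2 V → unitInterval) (S T : Set V)
    (E : Set (Set (Sym2 V) × (Set (Sym2 V))ᵒᵈ)) :
    ex (condPairWeight w S T) (ind E) = condPairProb w S T E := by
  set D : Set (BondConfig V) := {ω | ∀ s ∈ S, ∀ t ∈ T, ¬ (openGraph ω).Reachable s t} with hDdef
  have hDm : MeasurableSet D := MeasurableSet.of_discrete
  rw [ex_condPairWeight]
  unfold BHK2006.condPairProb
  simp only [← hDdef]
  congr 1
  rw [← integral_indicator_one (hDm.inter MeasurableSet.of_discrete), ← integral_indicator hDm]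
  refine integral_congr_ae (Filter.Eventually.of_forall fun ω => ?_)
  show D.indicator (fun ω => ind E (⋃ s ∈ S, openEdgeCluster ω s,
      OrderDual.toDual (⋃ t ∈ T, openEdgeCluster ω t))) ω =
    (D ∩ {ω | (⋃ s ∈ S, openEdgeCluster ω s,
      OrderDual.toDual (⋃ t ∈ T, openEdgeCluster ω t)) ∈ E}).indicator 1 ω
  by_cases hω : ω ∈ D
  · by_cases hE : (⋃ s ∈ S, openEdgeCluster ω s,
        OrderDual.toDual (⋃ t ∈ T, openEdgeCluster ω t)) ∈ E
    · rw [Set.indicator_of_mem hω, ind_of_mem hE, Set.indicator_of_mem (Set.mem_inter hω hE),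
        Pi.one_apply]
    · rw [Set.indicator_of_mem hω, ind_of_not_mem hE, Set.indicator_of_notMem (fun h => hE h.2)]
  · rw [Set.indicator_of_notMem hω, Set.indicator_of_notMem (fun h => hω h.1)]

/-- **The `n = 3` member, in conditional probabilities** ((3, BHK) ⇐ (3, product) of the one-cut
programme's MASTER-FAMILY table): IF Sahi's `E_3 ≥ 0` holds for nonnegative increasing functions under
every product measure on a finite cube (Sahi's Conjecture 5 at `n = 3` / Kahn's Conjecture 5 — OPEN,
taken as a hypothesis), THEN for any three events `A, B, C` of the state that are increasing in `C_S`
and decreasing in `C_T`, with `P = φ̂` the conditional probability given `{S ↮ T}`: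
`0 ≤ 2P(ABC) + P(A)P(B)P(C) − P(A)P(BC) − P(B)P(AC) − P(C)P(AB)`.
[cite: Kahn2022, Conj. 5 (p. 3); LiebSahi2021, Conj. 1.1 and eq. (2.1); VandenbergHaggstromKahn2005, §2.1 pp. 10–13] -/
theorem condSahiE3_nonneg_of_product
    (hC : ∀ (β : Type u) [Fintype β] (q : β → unitInterval), SahiPositive (bernoulliWeight q) 3)
    (w : Sym2 V → unitInterval) (S T : Set V)
    (hT : ∀ e : Sym2 V, ¬ e.IsDiag → (∃ v ∈ e, v ∈ T) → (w e : ℝ) < 1)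
    (hD : 0 < (prodBernoulli w).real
      {ω : BondConfig V | ∀ s ∈ S, ∀ t ∈ T, ¬ (openGraph ω).Reachable s t})
    {A B C : Set (Set (Sym2 V) × (Set (Sym2 V))ᵒᵈ)}
    (hA : IsUpperSet A) (hB : IsUpperSet B) (hC' : IsUpperSet C) :
    0 ≤ 2 * condPairProb w S T (A ∩ B ∩ C) +
        condPairProb w S T A * condPairProb w S T B * condPairProb w S T C -
      (condPairProb w S T A * condPairProb w S T (B ∩ C) +
        condPairProb w S T B * condPairProb w S T (A ∩ C) +
        condPairProb w S T C * condPairProb w S T (A ∩ B)) := by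
  have hmono : ∀ {E : Set (Set (Sym2 V) × (Set (Sym2 V))ᵒᵈ)}, IsUpperSet E → Monotone (ind E) := by
    intro E hE x y hxy
    by_cases hx : x ∈ E
    · rw [ind_of_mem hx, ind_of_mem (hE hxy hx)]
    · rw [ind_of_not_mem hx]; exact ind_nonneg E y
  have key := sahiPositive_condPairWeight_of_product 3 hC w S T hT hD ![ind A, ind B, ind C]
    (fun i x => by fin_cases i <;> exact ind_nonneg _ _)
    (fun i => by
      fin_cases i
      · exact hmono hA
      · exact hmono hB
      · exact hmono hC')
  rw [Literature.Combinatorics.Sahi2008.sahiE_three] at key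
  have hprod : ∀ E F : Set (Set (Sym2 V) × (Set (Sym2 V))ᵒᵈ), ind E * ind F = ind (E ∩ F) :=
    fun E F => funext fun x => (BHK2006.ind_inter E F x).symm
  simp only [hprod, ex_condPairWeight_ind] at key
  exact key

end Sahi

end Literature.Probability.Percolation
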